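import Summits.KontsevichZagierPeriods.KontsevichZagierPeriods.Theorems.RootDecompRelativeModAbsoluteCylLogSplitP51

/-! # `RootDecompRelativeModAbsoluteCylLogSplitP52` — part 27/27 of the mechanical ≤400-line split of `RungClosure.lean` (sha256 f909f334226f0fb5…)
Source: decomp-kz lens-3 g12 `RungClosure.lean` v9 (HOME/decomp-kz-lens-3/g12/, sha256 f909f334…; critic g4-52/g4-57/g5 CLEARED, «lander: split v9 --supports 30572»): BLOCK I (57 g11 monolith decls missing from P01–P25), BLOCK II/III (WildCertAssembly parts 1–6, 8–10: `Leaf.cellLocalWildCert`, `Leaf.cylKernelZeroLog_of_trees`), Parts 12–13 (`Leaf.regKernelPairDegOne_iff_circlePos_of_trees`), BLOCK G13 (Möbius engine, test §C decided).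
Split by census-1 g9 `gen/splitlean.py`: scopes re-opened with their `open`/`variable`/`set_option` context; mathematics and declaration order unchanged. -/

noncomputable section
open MeasureTheory Set
open Literature.NumberTheory.Transcendental Literature.ModelTheory.ExponentialFields
namespace Summit.KontsevichZagierPeriods.RootDecompRelativeModAbsolute.Rung30571.RegularisedLogLayer.CylLog.Leaf.G13
namespace TestC
open DegenerateInstance

/-- Auxiliary step `sa_a₀C`: sa a₀C. [bookkeeping] -/
theorem sa_a₀C : IsSemialgebraicFunOn ℚ G a₀C := sa_zero.congr fun _ _ => rfl
/-- Auxiliary step `integrableOn_a₀C`: integrable On a₀C. [bookkeeping] -/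
theorem integrableOn_a₀C : IntegrableOn a₀C G := by
  show IntegrableOn (fun _ => (0:ℝ)) G
  exact integrableOn_zero
/-- Auxiliary step `sa_cC`: sa c C. [bookkeeping] -/
theorem sa_cC : ∀ i, IsSemialgebraicFunOn ℚ G (cC i) := by
  intro i
  fin_cases i
  · exact sa_u
  · exact sa_inv_u
  · exact sa_m2
/-- Auxiliary step `sa_κC`: sa κC. [bookkeeping] -/
theorem sa_κC : ∀ i, IsSemialgebraicFunOn ℚ G (κC i) := by
  intro i
  fin_cases i
  · exact sa_usq
  · exact sa_invusq
  · exact sa_one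
/-- Auxiliary step `eC_spec`: e C spec. [bookkeeping] -/
theorem eC_spec : ∀ i, eC i = 1 ∨ eC i = 2 := fun _ => Or.inr rfl
/-- Auxiliary step `eC_two`: e C two. [bookkeeping] -/
theorem eC_two : ∃ i, eC i = 2 := ⟨0, rfl⟩
/-- Auxiliary step `κC_gt`: κC gt. [bookkeeping] -/
theorem κC_gt : ∀ i, ∀ x ∈ G, -1 < κC i x := by
  intro i x hx
  fin_cases i
  · exact neg_one_lt_zero.trans_le (sq_nonneg (u x))
  · exact neg_one_lt_zero.trans_le (sq_nonneg (1 / u x))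
  · show (-1:ℝ) < 1; norm_num
/-- Auxiliary step `κC_pos`: κC pos. [bookkeeping] -/
theorem κC_pos : ∀ i, eC i = 2 → ∀ x ∈ G, 0 < κC i x := by
  intro i _ x hx
  have hU := u_pos hx
  fin_cases i
  · exact pow_pos hU 2
  · show 0 < (1 / u x) ^ 2; positivity
  · show (0:ℝ) < 1; norm_num

/-- Auxiliary step `box_subset_band`: box subset band. [bookkeeping] -/
theorem box_subset_band : box ⊆ KZlog.band G (fun _ => (0:ℝ)) (fun _ => 1) := box_subset
/-- Auxiliary step `measurableSet_box`: measurable Set box. [bookkeeping] -/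
private theorem measurableSet_box : MeasurableSet box := isSemialgebraic_box.measurableSet_holds

/-- the unfolded summands are integrable on the open box (restrictions of `T1, T2, T3`). -/
theorem hint_C : ∀ i, IntegrableOn (fun z : Fin (1 + 1) → ℝ =>
    cC i (Fin.init z) * (z (Fin.last 1) ^ MC i / (1 + z (Fin.last 1) ^ eC i * κC i (Fin.init z)))) box := by
  intro i
  fin_cases i
  · refine (T1.integrableOn.mono_set box_subset_band).congr_fun (fun z _ => ?_) measurableSet_box
    show f₁ z = u (Fin.init z) * (z (Fin.last 1) ^ (0:ℕ) / (1 + z (Fin.last 1) ^ (2:ℕ) * u (Fin.init z) ^ 2))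
    simp only [f₁, pow_zero]; ring
  · refine (T2.integrableOn.mono_set box_subset_band).congr_fun (fun z _ => ?_) measurableSet_box
    show f₂ z = (1 / u (Fin.init z)) * (z (Fin.last 1) ^ (0:ℕ) / (1 + z (Fin.last 1) ^ (2:ℕ) * (1 / u (Fin.init z)) ^ 2))
    simp only [f₂, pow_zero]; ring
  · refine (T3.integrableOn.mono_set box_subset_band).congr_fun (fun z _ => ?_) measurableSet_box
    show f₃ z = (-2:ℝ) * (z (Fin.last 1) ^ (0:ℕ) / (1 + z (Fin.last 1) ^ (2:ℕ) * (1:ℝ)))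
    simp only [f₃, pow_zero]; ring

/-- Auxiliary step `integrableOn_const_G`: integrable On const G. [bookkeeping] -/
theorem integrableOn_const_G (C : ℝ) : IntegrableOn (fun _ : Fin 1 → ℝ => C) G := by
  haveI : IsFiniteMeasure (volume.restrict G) := ⟨by rw [Measure.restrict_apply_univ]; exact volume_G_lt_top⟩
  exact integrable_const C

/-- the fibre integrals `cᵢ ∫₀¹ …` are integrable on `G` (they are `arctan u`, `arctan u⁻¹`, `−π/2`). -/
theorem hL1_C : ∀ i, IntegrableOn (fun x : Fin 1 → ℝ =>
    cC i x * ∫ θ in Ioo (0:ℝ) 1, θ ^ MC i / (1 + θ ^ eC i * κC i x)) G := by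
  have hGm : MeasurableSet G := isSemialgebraic_G.measurableSet_holds
  have hc0 : Continuous fun x : Fin 1 → ℝ => x 0 := continuous_apply 0
  intro i
  fin_cases i
  · have hcont : ContinuousOn (fun x : Fin 1 → ℝ => Real.arctan (u x)) (Icc 0 1) :=
      (Real.continuous_arctan.comp (continuous_const.add hc0)).continuousOn
    refine ((hcont.integrableOn_compact isCompact_Icc).mono_set G_subset_Icc).congr_fun (fun x hx => ?_) hGm
    have hU := u_pos hx
    show Real.arctan (u x) = u x * ∫ θ in Ioo (0:ℝ) 1, θ ^ (0:ℕ) / (1 + θ ^ (2:ℕ) * u x ^ 2)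
    rw [integral_kernel (u x) hU]
    field_simp
  · have hcont : ContinuousOn (fun x : Fin 1 → ℝ => Real.arctan (1 / u x)) (Icc 0 1) := by
      refine Real.continuous_arctan.comp_continuousOn (ContinuousOn.div continuousOn_const
        (continuous_const.add hc0).continuousOn fun x hx => ?_)
      have : (0:ℝ) ≤ x 0 := by
        have h := hx.1; rw [Pi.le_def] at h; simpa using h 0
      show (1:ℝ) + x 0 ≠ 0
      positivity
    refine ((hcont.integrableOn_compact isCompact_Icc).mono_set G_subset_Icc).congr_fun (fun x hx => ?_) hGm
    have hU := u_pos hx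
    have hU' : 0 < 1 / u x := by positivity
    show Real.arctan (1 / u x) = (1 / u x) * ∫ θ in Ioo (0:ℝ) 1, θ ^ (0:ℕ) / (1 + θ ^ (2:ℕ) * (1 / u x) ^ 2)
    rw [integral_kernel (1 / u x) hU']
    field_simp
  · refine (integrableOn_const_G ((-2:ℝ) * (Real.pi / 4))).congr_fun (fun x _ => ?_) hGm
    show (-2:ℝ) * (Real.pi / 4) = (-2:ℝ) * ∫ θ in Ioo (0:ℝ) 1, θ ^ (0:ℕ) / (1 + θ ^ (2:ℕ) * (1:ℝ))
    have h := integral_kernel 1 one_pos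
    rw [one_pow, div_one, Real.arctan_one] at h
    rw [h]

/-- Auxiliary step `hae_C`: hae C. [bookkeeping] -/
theorem hae_C : ∀ᵐ x : (Fin 1 → ℝ), x ∈ G →
    a₀C x + ∑ i, cC i x * ∫ θ in Ioo (0:ℝ) 1, θ ^ MC i / (1 + θ ^ eC i * κC i x) = 0 :=
  ae_of_all _ fibre_identity

/-! ### Test §C is an INSTANCE of the residual `Leaf.CylKernelZeroCirclePos` (every hypothesis discharged above),
and its conclusion is PROVED unconditionally (`TestC.of_mem_relations`): the residual is DECIDED (true) on the
standing circle test. -/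

/-- The residual, applied to the Test §C data, yields exactly the (independently proved) conclusion
`TestC.of_mem_relations` — i.e. Test §C is a bona fide instance of `CylKernelZeroCirclePos`. -/
theorem of_circlePos (h : CylKernelZeroCirclePos) (V : KZ.IntegralRep (1 + 1)) (hdom : V.domain = box)
    (hV : EqOn V.integrand FC V.domain) : KZ.of V ∈ KZ.relations :=
  h G V a₀C 3 cC κC MC eC isOpen_G isSemialgebraic_G sa_a₀C integrableOn_a₀C sa_cC sa_κC eC_spec eC_two
    κC_gt κC_pos hint_C hL1_C hdom hV hae_C

/-- … and the same conclusion holds outright, by eleven explicit Kontsevich–Zagier moves. -/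
theorem decided (V : KZ.IntegralRep (1 + 1)) (hdom : V.domain = box) (hV : EqOn V.integrand FC V.domain) :
    KZ.of V ∈ KZ.relations :=
  of_mem_relations V hdom hV

end TestC

end Summit.KontsevichZagierPeriods.RootDecompRelativeModAbsolute.Rung30571.RegularisedLogLayer.CylLog.Leaf.G13
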